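import Mathlib
import HarnessLib
import Literature.MathematicalPhysics.QuantumLattice.KohnLuttingerFermiCurvePolar
import Literature.MathematicalPhysics.QuantumLattice.HubbardBandSectorCountingToolbox

/-!
# Route `KLProgramme` (cruxes K3 `KLRegimeTwoPointLimit`, K1 `H10TwoPointLimit`): FST II's filling
# restriction A5 holds iff `μ < -2` — umklapp pairs, quadruples and corners on the Kohn–Luttinger window

Cell `gate-hubbard-kl`, risk-register item r2. For the free band `ε(k) = -2 (cos k₁ + cos k₂)` and its Fermi
curve `F_μ` (`-4 < μ < 0`, `K(μ) = umklappRadius μ = arccos (-μ/2 - 1)` = the largest coordinate on `F_μ`):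

* §4a **A5** (`{u p + v q : p, q ∈ F, u, v = ±1} ⊂` open cell `(-π, π)²`, FST II p.7: «in the Hubbard
  model … fulfilled for densities `n < 0.369`») **HOLDS for `μ < -2`** (`klfs_A5_of_lt_neg_two`, from
  `umklappRadius_lt_pi_div_two`) and **FAILS on `[-2, 0)`** — hence on both programme windows
  `μ ∈ [-0.4267, -0.1798]` (⟸ `δ ∈ [0.10, 0.20]`) and `[-1, -0.15]`: the antinodal pair `p = q = (K(μ), 0)`
  has `p₀ + q₀ = 2K(μ) ≥ π` (`klfs_not_A5_of_neg_two_le`, strict `> π` on `(-2, 0)`; `Momentum` form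
  `klfs_not_A5_momentum`: `p + q ∉ brillouinZone`);
* §4b **four-leg umklapp exists on `[-2, 0)`**: `(π/2, ±y₀)`, `y₀ = arccos (-μ/2)`, twice each, sum to
  `2π (1, 0)` (`klfs_exists_umklapp_quadruple`) — the tree's `eq_zero_of_sum_eq_of_lt_neg_two` is sharp
  and `umklapp_cooper_disjoint` is not vacuous on the window;
* §4c **the umklapp corner `3p ∈ F + G`, `G ≠ 0`** of the second-order self-energy (DECOMP App. A / C,
  crux C4b `UmklappPointRegularity`) **exists iff `μ > -2`**: for `-2 < μ < 0` an angle `θ* ∈ (0, π/4)`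
  with `ε(3 p(θ*)) = μ`, `‖3 p(θ*)‖_∞ > π` (`klfs_exists_corner`: IVT between the antinode, where
  `ε(3p) - μ = 8c(1 - c²) < 0`, and the node, where `ε(3p) - μ = 16e(1 - e²) > 0`), and NO such angle for
  `μ < -2` (`klfs_no_corner_of_lt_neg_two`: fold-back + uniqueness of the Fermi radius). So «A5 fails on
  the window ⇒ C4b is load-bearing» is a theorem (`klfs_windows_corner`), not prose.

A2–A4 with constants: `KLProgrammeFermiSurfaceEnvelope.lean`. No definitions; everything PROVED. [folklore]
-/

noncomputable section

open Real Set

-- the tree's namespace `Summit.<Summit>.<Problem>.Theorems` repeats the summit name by design (D-0017)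
set_option linter.dupNamespace false

namespace Summit.HubbardSuperconductivity.HubbardSuperconductivity.Theorems

open Literature.MathematicalPhysics.QuantumLattice

/-! ### §4 (A5) The filling restriction holds iff `μ < -2`; umklapp on the window -/

/-- **A5 HOLDS below `μ = -2`**: for `-4 ≤ μ < -2` and any two points `p, q` of the Fermi curve
(fundamental domain `|kᵢ| ≤ π`), every signed sum `u p + v q`, `u, v = ±1`, lies in the OPEN cell
`(-π, π)²` (each coordinate is at most `2 K(μ) < π`, `umklappRadius_lt_pi_div_two`). This is FST II's
«`n < 0.369`». [folklore] -/
theorem klfs_A5_of_lt_neg_two {μ : ℝ} (hμ₁ : -4 ≤ μ) (hμ₂ : μ < -2) {p q : Fin 2 → ℝ}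
    (hp : ∀ i, |p i| ≤ π) (hq : ∀ i, |q i| ≤ π) (hpe : sqDispersion p = μ) (hqe : sqDispersion q = μ)
    {u v : ℝ} (hu : u = 1 ∨ u = -1) (hv : v = 1 ∨ v = -1) (i : Fin 2) : |u * p i + v * q i| < π := by
  have hK := umklappRadius_lt_pi_div_two hμ₁ hμ₂
  have h1 := abs_le_umklappRadius_of_sqDispersion_eq hp hpe i
  have h2 := abs_le_umklappRadius_of_sqDispersion_eq hq hqe i
  have hu1 : |u| = 1 := by rcases hu with rfl | rfl <;> simp
  have hv1 : |v| = 1 := by rcases hv with rfl | rfl <;> simp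
  calc |u * p i + v * q i| ≤ |u * p i| + |v * q i| := abs_add_le _ _
    _ = |p i| + |q i| := by rw [abs_mul, abs_mul, hu1, hv1, one_mul, one_mul]
    _ < π := by linarith

/-- The antinodal point `(K(μ), 0)`, `K(μ) = arccos (-μ/2 - 1)`, lies on the Fermi curve, in the open
cell, for `-4 ≤ μ < 0`. [folklore] -/
theorem klfs_antinode_on_curve {μ : ℝ} (hμ₁ : -4 ≤ μ) (hμ₂ : μ < 0) :
    sqDispersion ![umklappRadius μ, 0] = μ ∧ ∀ i, |(![umklappRadius μ, 0] : Fin 2 → ℝ) i| < π := by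
  have hc : Real.cos (umklappRadius μ) = -μ / 2 - 1 := by
    rw [umklappRadius, Real.cos_arccos (by linarith) (by linarith)]
  refine ⟨by simp [sqDispersion, hc]; ring, fun i => ?_⟩
  fin_cases i
  · simpa [abs_of_nonneg (umklappRadius_nonneg μ)] using umklappRadius_lt_pi hμ₂
  · simpa using Real.pi_pos

/-- **A5 FAILS on `[-2, 0)`** (hence on both programme windows): the antinodal pair `p = q = (K(μ), 0)`
of curve points in the open cell has `p₀ + q₀ = 2 K(μ) ≥ π` (`pi_div_two_le_umklappRadius`), i.e.
`p + q` leaves the open cell `(-π, π)²`. [folklore] -/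
theorem klfs_not_A5_of_neg_two_le {μ : ℝ} (hμ₁ : -2 ≤ μ) (hμ₂ : μ < 0) :
    ∃ p q : Fin 2 → ℝ, (∀ i, |p i| < π) ∧ (∀ i, |q i| < π) ∧ sqDispersion p = μ ∧ sqDispersion q = μ ∧
      π ≤ |p 0 + q 0| := by
  obtain ⟨he, habs⟩ := klfs_antinode_on_curve (by linarith) hμ₂
  refine ⟨![umklappRadius μ, 0], ![umklappRadius μ, 0], habs, habs, he, he, ?_⟩
  have hK := pi_div_two_le_umklappRadius hμ₁
  have : (![umklappRadius μ, 0] : Fin 2 → ℝ) 0 = umklappRadius μ := rfl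
  rw [this, abs_of_nonneg (by linarith [umklappRadius_nonneg μ])]
  linarith

/-- From `cos K ≤ -t < 0`... precisely: for `-2 < μ < 0`, `π/2 < K(μ)` strictly. [folklore] -/
theorem klfs_pi_div_two_lt_umklappRadius {μ : ℝ} (hμ₁ : -2 < μ) (hμ₂ : μ < 0) :
    π / 2 < umklappRadius μ := by
  unfold umklappRadius
  rw [← Real.arccos_zero]
  exact Real.arccos_lt_arccos (by linarith) (by linarith) (by norm_num)

/-- Strict version on `(-2, 0)`: the antinodal pair sum even leaves the CLOSED cell, `p₀ + q₀ > π`.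
[folklore] -/
theorem klfs_not_A5_strict {μ : ℝ} (hμ₁ : -2 < μ) (hμ₂ : μ < 0) :
    ∃ p q : Fin 2 → ℝ, (∀ i, |p i| < π) ∧ (∀ i, |q i| < π) ∧ sqDispersion p = μ ∧ sqDispersion q = μ ∧
      π < |p 0 + q 0| := by
  obtain ⟨he, habs⟩ := klfs_antinode_on_curve (by linarith) hμ₂
  refine ⟨![umklappRadius μ, 0], ![umklappRadius μ, 0], habs, habs, he, he, ?_⟩
  have hK := klfs_pi_div_two_lt_umklappRadius hμ₁ hμ₂
  have : (![umklappRadius μ, 0] : Fin 2 → ℝ) 0 = umklappRadius μ := rfl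
  rw [this, abs_of_nonneg (by linarith [umklappRadius_nonneg μ])]
  linarith

/-- **A5 fails on `[-2, 0)`, `KohnLuttinger` vocabulary**: there are `p, q ∈ fermiCurve ε μ` with
`p + q ∉ brillouinZone` (the sum's first coordinate is `2 K(μ) ≥ π`). [folklore] -/
theorem klfs_not_A5_momentum {μ : ℝ} (hμ₁ : -2 ≤ μ) (hμ₂ : μ < 0) :
    ∃ p q : Momentum, p ∈ fermiCurve (squareDispersion 1 0) μ ∧ q ∈ fermiCurve (squareDispersion 1 0) μ ∧
      p + q ∉ brillouinZone := by
  obtain ⟨he, habs⟩ := klfs_antinode_on_curve (by linarith) hμ₂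
  set P : Momentum := WithLp.toLp 2 ![umklappRadius μ, 0] with hP
  have hPmem : P ∈ fermiCurve (squareDispersion 1 0) μ := by
    refine ⟨fun i => ?_, ?_⟩
    · have h := habs i
      rw [abs_lt] at h
      have : P i = (![umklappRadius μ, 0] : Fin 2 → ℝ) i := by simp [hP]
      rw [this]
      exact ⟨h.1.le, h.2⟩
    · have : squareDispersion 1 0 P = sqDispersion ![umklappRadius μ, 0] := by
        simp [hP, squareDispersion, sqDispersion]
      rw [this, he]
  refine ⟨P, P, hPmem, hPmem, fun hBZ => ?_⟩
  have h0 := (hBZ 0).2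
  have hK := pi_div_two_le_umklappRadius hμ₁
  have : (P + P) 0 = 2 * umklappRadius μ := by simp [hP]; ring
  rw [this] at h0
  linarith

/-- **Four-leg umklapp EXISTS on `[-2, 0)`**: the curve points `k₁ = k₂ = (π/2, y₀)`, `k₃ = k₄ = (π/2, -y₀)`,
`y₀ = arccos (-μ/2)`, all in the open cell, sum to the non-zero reciprocal vector `2π (1, 0)`. So the
tree's `eq_zero_of_sum_eq_of_lt_neg_two` (no four-leg umklapp for `μ < -2`) is sharp, and on the window the
hypothesis of `umklapp_cooper_disjoint` is not vacuous. [folklore] -/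
theorem klfs_exists_umklapp_quadruple {μ : ℝ} (hμ₁ : -2 ≤ μ) (hμ₂ : μ < 0) :
    ∃ k : Fin 4 → Fin 2 → ℝ, (∀ j i, |k j i| < π) ∧ (∀ j, sqDispersion (k j) = μ) ∧
      (![(1 : ℤ), 0] : Fin 2 → ℤ) ≠ 0 ∧ ∀ i, ∑ j, k j i = 2 * π * ((![(1 : ℤ), 0] : Fin 2 → ℤ) i : ℝ) := by
  set y₀ := Real.arccos (-μ / 2) with hy₀
  have hcy : Real.cos y₀ = -μ / 2 := Real.cos_arccos (by linarith) (by linarith)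
  have hy₀π : y₀ < π := by
    rw [hy₀]
    have h : Real.arccos (-μ / 2) ≠ π := by rw [Ne, Real.arccos_eq_pi]; push Not; linarith
    exact lt_of_le_of_ne (Real.arccos_le_pi _) h
  have hy₀0 : 0 ≤ y₀ := Real.arccos_nonneg _
  have hpi := Real.pi_pos
  refine ⟨![![π / 2, y₀], ![π / 2, y₀], ![π / 2, -y₀], ![π / 2, -y₀]], ?_, ?_, by simp, ?_⟩
  · intro j i
    fin_cases j <;> fin_cases i <;>
      simp [abs_of_pos (half_pos hpi), abs_of_nonneg hy₀0, abs_neg, hy₀π, half_lt_self hpi]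
  · intro j
    fin_cases j <;> simp [sqDispersion, Real.cos_pi_div_two, hcy, Real.cos_neg] <;> ring
  · intro i
    fin_cases i
    · simp [Fin.sum_univ_four]; ring
    · simp [Fin.sum_univ_four]

/-! #### The umklapp corner `3p ∈ F + G`, `G ≠ 0`, of the second-order self-energy (DECOMP App. A / C4b) -/

section Corner

/-- `‖dir 0‖ = 1`. [folklore] -/
theorem klfs_norm_dir_zero : ‖dir 0‖ = 1 := by
  rw [norm_dir, Real.cos_zero, Real.sin_zero]; simp

/-- `‖dir (π/4)‖ = √2/2`. [folklore] -/
theorem klfs_norm_dir_pi_div_four : ‖dir (π / 4)‖ = Real.sqrt 2 / 2 := by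
  rw [norm_dir, Real.cos_pi_div_four, Real.sin_pi_div_four, max_self, abs_of_pos (by positivity)]

/-- `√2 · s · (√2/2) = s`. [folklore] -/
theorem klfs_sqrt_two_mul_mul_half (s : ℝ) : Real.sqrt 2 * s * (Real.sqrt 2 / 2) = s := by
  rw [show Real.sqrt 2 * s * (Real.sqrt 2 / 2) = Real.sqrt 2 * Real.sqrt 2 / 2 * s by ring,
    Real.mul_self_sqrt (by norm_num : (0 : ℝ) ≤ 2)]
  ring

/-- `F(0, t) = -2 (cos t + 1)`. [folklore] -/
theorem klfs_rayDispersion_zero (t : ℝ) : rayDispersion (0, t) = -2 * (Real.cos t + 1) := by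
  rw [rayDispersion_eq]; simp

/-- `F(π/4, √2 s) = -4 cos s`. [folklore] -/
theorem klfs_rayDispersion_pi_div_four (s : ℝ) :
    rayDispersion (π / 4, Real.sqrt 2 * s) = -4 * Real.cos s := by
  rw [rayDispersion_eq]
  simp only [Real.cos_pi_div_four, Real.sin_pi_div_four]
  rw [klfs_sqrt_two_mul_mul_half]; ring

variable {μ : ℝ} (hμ₁ : -4 < μ) (hμ₂ : μ < 0)
include hμ₁ hμ₂

/-- **The antinodal radius**: `u_μ(0) = K(μ) = arccos (-μ/2 - 1)`. [folklore] -/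
theorem klfs_bandFermiRadius_zero : bandFermiRadius μ 0 = umklappRadius μ := by
  symm
  refine bandFermiRadius_unique hμ₁ hμ₂ ⟨⟨umklappRadius_nonneg μ, ?_⟩, ?_⟩
  · rw [klfs_norm_dir_zero, mul_one]; exact Real.arccos_le_pi _
  · rw [klfs_rayDispersion_zero, umklappRadius, Real.cos_arccos (by linarith) (by linarith)]; ring

/-- **The nodal radius**: `u_μ(π/4) = √2 · arccos (-μ/4)`. [folklore] -/
theorem klfs_bandFermiRadius_pi_div_four : bandFermiRadius μ (π / 4) = Real.sqrt 2 * Real.arccos (-μ / 4) := by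
  symm
  refine bandFermiRadius_unique hμ₁ hμ₂
    ⟨⟨mul_nonneg (Real.sqrt_nonneg _) (Real.arccos_nonneg _), ?_⟩, ?_⟩
  · rw [klfs_norm_dir_pi_div_four, klfs_sqrt_two_mul_mul_half]; exact Real.arccos_le_pi _
  · rw [klfs_rayDispersion_pi_div_four, Real.cos_arccos (by linarith) (by linarith)]; ring

/-- At the antinode the tripled point is INSIDE the Fermi sea when `-2 < μ`: `ε(3 p(0)) < μ`
(`ε(3p(0)) - μ = 8 c (1 - c²)` with `c = cos K(μ) = -μ/2 - 1 ∈ (-1, 0)`). [folklore] -/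
theorem klfs_rayDispersion_triple_antinode_lt (hμ : -2 < μ) :
    rayDispersion (0, 3 * bandFermiRadius μ 0) < μ := by
  rw [klfs_bandFermiRadius_zero hμ₁ hμ₂, klfs_rayDispersion_zero, Real.cos_three_mul, umklappRadius,
    Real.cos_arccos (by linarith) (by linarith)]
  set c : ℝ := -μ / 2 - 1 with hc
  have hc0 : c < 0 := by rw [hc]; linarith
  have hc1 : -1 < c := by rw [hc]; linarith
  have hμc : μ = -2 * (c + 1) := by rw [hc]; ring
  rw [hμc]
  nlinarith [mul_pos (neg_pos.2 hc0) (mul_pos (by linarith : 0 < 1 + c) (by linarith : 0 < 1 - c))]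

/-- At the node the tripled point is OUTSIDE the Fermi sea: `μ < ε(3 p(π/4))`
(`ε(3p(π/4)) - μ = 16 e (1 - e²)`, `e = -μ/4 ∈ (0, 1)`). [folklore] -/
theorem klfs_lt_rayDispersion_triple_node : μ < rayDispersion (π / 4, 3 * bandFermiRadius μ (π / 4)) := by
  rw [klfs_bandFermiRadius_pi_div_four hμ₁ hμ₂,
    show 3 * (Real.sqrt 2 * Real.arccos (-μ / 4)) = Real.sqrt 2 * (3 * Real.arccos (-μ / 4)) by ring,
    klfs_rayDispersion_pi_div_four, Real.cos_three_mul, Real.cos_arccos (by linarith) (by linarith)]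
  set e : ℝ := -μ / 4 with he
  have he0 : 0 < e := by rw [he]; linarith
  have he1 : e < 1 := by rw [he]; linarith
  have hμe : μ = -4 * e := by rw [he]; ring
  rw [hμe]
  nlinarith [mul_pos he0 (mul_pos (by linarith : 0 < 1 - e) (by linarith : 0 < 1 + e))]

/-- `θ ↦ ε(3 p(θ))` is continuous. [folklore] -/
theorem klfs_continuous_rayDispersion_triple :
    Continuous fun θ : ℝ => rayDispersion (θ, 3 * bandFermiRadius μ θ) :=
  contDiff_rayDispersion (n := 0) |>.continuous.comp
    (continuous_id.prodMk (continuous_const.mul (continuous_bandFermiRadius hμ₁ hμ₂)))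

/-- A tripled curve point that lands on the level must have left the closed cell: if
`ε(3 p(θ)) = μ` then `‖3 p(θ)‖_∞ > π` (otherwise `3 u(θ)` would be a second Fermi radius on the ray,
contradicting uniqueness) — so a NON-ZERO reciprocal vector `G` folds it back: `3p ∈ F + G`. [folklore] -/
theorem klfs_triple_norm_gt_pi {θ : ℝ} (h : rayDispersion (θ, 3 * bandFermiRadius μ θ) = μ) :
    π < ‖(3 * bandFermiRadius μ θ) • dir θ‖ := by
  have hu := bandFermiRadius_pos hμ₁ hμ₂ θ
  rw [norm_smul_dir (by positivity)]
  by_contra hle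
  push Not at hle
  have h3 : 3 * bandFermiRadius μ θ = bandFermiRadius μ θ :=
    bandFermiRadius_unique hμ₁ hμ₂ ⟨⟨by positivity, hle⟩, h⟩
  linarith

/-- **The umklapp corner EXISTS for `-2 < μ < 0`** (DECOMP App. A (1): «corners exist iff `μ > -2`»):
there is an angle `θ* ∈ (0, π/4)` with `ε(3 p(θ*)) = μ` and `‖3 p(θ*)‖_∞ > π`, i.e. `3 p(θ*) ∈ F + G`
with `G ∈ 2πℤ² ∖ {0}` — the degenerate configuration of the second-order self-energy whose tangential
logarithm is crux C4b. Intermediate value theorem between the antinode (inside) and the node (outside).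
[folklore] -/
theorem klfs_exists_corner (hμ : -2 < μ) :
    ∃ θ ∈ Ioo (0 : ℝ) (π / 4), rayDispersion (θ, 3 * bandFermiRadius μ θ) = μ ∧
      π < ‖(3 * bandFermiRadius μ θ) • dir θ‖ := by
  have hcont := (klfs_continuous_rayDispersion_triple hμ₁ hμ₂).continuousOn (s := Icc (0 : ℝ) (π / 4))
  have hivt := intermediate_value_Ioo (show (0 : ℝ) ≤ π / 4 by positivity) hcont
  obtain ⟨θ, hθ, hθe⟩ := hivt ⟨klfs_rayDispersion_triple_antinode_lt hμ₁ hμ₂ hμ,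
    klfs_lt_rayDispersion_triple_node hμ₁ hμ₂⟩
  exact ⟨θ, hθ, hθe, klfs_triple_norm_gt_pi hμ₁ hμ₂ hθe⟩

/-- **NO umklapp corner for `-4 < μ < -2`** (the converse half of «iff `μ > -2`»): `ε(3 p(θ)) ≠ μ` for
every angle. Folding `3 p(θ)` back into the cell coordinatewise gives a curve point `q` with
`|qᵢ| ≤ K(μ) < π/2`, while `|3 pᵢ| ≤ 3 K(μ)`; so the folding vector has `|2π nᵢ| ≤ 4 K(μ) < 2π`, `n = 0`,
and `3 u(θ)` would be a second Fermi radius on the ray. [folklore] -/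
theorem klfs_no_corner_of_lt_neg_two (hμ : μ < -2) (θ : ℝ) :
    rayDispersion (θ, 3 * bandFermiRadius μ θ) ≠ μ := by
  intro h
  have hu := bandFermiRadius_pos hμ₁ hμ₂ θ
  have hK := umklappRadius_lt_pi_div_two hμ₁.le hμ
  set p : Fin 2 → ℝ := bandFermiRadius μ θ • dir θ with hp
  have hpabs : ∀ i, |p i| ≤ π := fun i => by
    have := abs_bandFermiRadius_mul_dir_lt hμ₁ hμ₂ θ i
    simpa [hp, smul_eq_mul] using this.le
  have hpe : sqDispersion p = μ := sqDispersion_bandFermiRadius hμ₁ hμ₂ θ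
  have hpK : ∀ i, |p i| ≤ umklappRadius μ := abs_le_umklappRadius_of_sqDispersion_eq hpabs hpe
  -- fold `3p` back into the cell
  obtain ⟨m₀, hm₀⟩ := BandSectorCounting.exists_int_abs_sub_le_pi (3 * p 0)
  obtain ⟨m₁, hm₁⟩ := BandSectorCounting.exists_int_abs_sub_le_pi (3 * p 1)
  set q : Fin 2 → ℝ := ![3 * p 0 - m₀ * (2 * π), 3 * p 1 - m₁ * (2 * π)] with hq
  have hqabs : ∀ i, |q i| ≤ π := fun i => by fin_cases i <;> simpa [hq]
  have h3e : sqDispersion ((3 * bandFermiRadius μ θ) • dir θ) = μ := h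
  have hqe : sqDispersion q = μ := by
    rw [← h3e, BandSectorCounting.sqDispersion_eq_eps2, BandSectorCounting.sqDispersion_eq_eps2]
    simp only [hq, hp, Matrix.cons_val_zero, Matrix.cons_val_one, Pi.smul_apply, smul_eq_mul]
    rw [BandSectorCounting.eps2_sub_int_mul]; ring_nf
  have hqK : ∀ i, |q i| ≤ umklappRadius μ := abs_le_umklappRadius_of_sqDispersion_eq hqabs hqe
  -- the folding vector vanishes
  have hm : ∀ (x : ℝ) (m : ℤ), |x| ≤ umklappRadius μ → |3 * x - m * (2 * π)| ≤ umklappRadius μ → m = 0 := by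
    intro x m hx hxm
    have h1 : |(m : ℝ) * (2 * π)| ≤ |3 * x| + |3 * x - m * (2 * π)| := by
      have := abs_sub (3 * x) (3 * x - m * (2 * π))
      rwa [show 3 * x - (3 * x - m * (2 * π)) = m * (2 * π) by ring] at this
    have e1 : |(m : ℝ) * (2 * π)| = |(m : ℝ)| * (2 * π) := by rw [abs_mul, abs_of_pos Real.two_pi_pos]
    have e2 : |3 * x| = 3 * |x| := by rw [abs_mul, abs_of_pos (by norm_num : (0 : ℝ) < 3)]
    rw [e1, e2] at h1
    have h3 : |(m : ℝ)| * (2 * π) < 1 * (2 * π) := by linarith [Real.pi_pos]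
    have h2 : |(m : ℝ)| < 1 := lt_of_mul_lt_mul_right h3 (by positivity)
    rw [← Int.cast_abs] at h2
    have h3 : |m| < 1 := by exact_mod_cast h2
    simpa using Int.abs_lt_one_iff.1 h3
  have hm₀0 : m₀ = 0 := hm (p 0) m₀ (hpK 0) (by simpa [hq] using hqK 0)
  have hm₁0 : m₁ = 0 := hm (p 1) m₁ (hpK 1) (by simpa [hq] using hqK 1)
  -- hence `3p` itself lies in the closed cell: contradiction with `klfs_triple_norm_gt_pi`
  have h3abs : ∀ i, |((3 * bandFermiRadius μ θ) • dir θ) i| ≤ π := by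
    intro i
    have hi : ((3 * bandFermiRadius μ θ) • dir θ) i = 3 * p i := by
      simp [hp, smul_eq_mul]; ring
    rw [hi]
    fin_cases i
    · have := hqabs 0; simpa [hq, hm₀0] using this
    · have := hqabs 1; simpa [hq, hm₁0] using this
  have hnorm : ‖(3 * bandFermiRadius μ θ) • dir θ‖ ≤ π :=
    (pi_norm_le_iff_of_nonneg Real.pi_pos.le).2 fun i => by rw [Real.norm_eq_abs]; exact h3abs i
  exact absurd (klfs_triple_norm_gt_pi hμ₁ hμ₂ h) (not_lt.2 hnorm)

end Corner

/-! ### §4d The two programme windows -/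

/-- **A5 fails on both windows** (they lie in `[-2, 0)`), in the strict form: an antinodal pair of curve
points in the open cell has `p₀ + q₀ > π`. [folklore] -/
theorem klfs_windows_not_A5 {μ : ℝ} (hμ : μ ∈ Icc (-0.4267 : ℝ) (-0.1798) ∨ μ ∈ Icc (-1 : ℝ) (-0.15)) :
    ∃ p q : Fin 2 → ℝ, (∀ i, |p i| < π) ∧ (∀ i, |q i| < π) ∧ sqDispersion p = μ ∧ sqDispersion q = μ ∧
      π < |p 0 + q 0| := by
  rcases hμ with hμ | hμ
  · exact klfs_not_A5_strict (by linarith [hμ.1]) (by linarith [hμ.2])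
  · exact klfs_not_A5_strict (by linarith [hμ.1]) (by linarith [hμ.2])

/-- **Umklapp corners exist on both windows**: «A5 fails ⇒ C4b is load-bearing», as a theorem. [folklore] -/
theorem klfs_windows_corner {μ : ℝ} (hμ : μ ∈ Icc (-0.4267 : ℝ) (-0.1798) ∨ μ ∈ Icc (-1 : ℝ) (-0.15)) :
    ∃ θ ∈ Ioo (0 : ℝ) (π / 4), rayDispersion (θ, 3 * bandFermiRadius μ θ) = μ ∧
      π < ‖(3 * bandFermiRadius μ θ) • dir θ‖ := by
  rcases hμ with hμ | hμ
  · exact klfs_exists_corner (by linarith [hμ.1]) (by linarith [hμ.2]) (by linarith [hμ.1])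
  · exact klfs_exists_corner (by linarith [hμ.1]) (by linarith [hμ.2]) (by linarith [hμ.1])

/-- **Four-leg umklapp quadruples exist on both windows.** [folklore] -/
theorem klfs_windows_umklapp_quadruple {μ : ℝ}
    (hμ : μ ∈ Icc (-0.4267 : ℝ) (-0.1798) ∨ μ ∈ Icc (-1 : ℝ) (-0.15)) :
    ∃ k : Fin 4 → Fin 2 → ℝ, (∀ j i, |k j i| < π) ∧ (∀ j, sqDispersion (k j) = μ) ∧
      (![(1 : ℤ), 0] : Fin 2 → ℤ) ≠ 0 ∧ ∀ i, ∑ j, k j i = 2 * π * ((![(1 : ℤ), 0] : Fin 2 → ℤ) i : ℝ) := by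
  rcases hμ with hμ | hμ
  · exact klfs_exists_umklapp_quadruple (by linarith [hμ.1]) (by linarith [hμ.2])
  · exact klfs_exists_umklapp_quadruple (by linarith [hμ.1]) (by linarith [hμ.2])

end Summit.HubbardSuperconductivity.HubbardSuperconductivity.Theorems

end
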